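import Literature.NumberTheory.ComplexMultiplication.ComplexReflexField
import HarnessLib

/-!
# The stabiliser of a CM type in `Aut(ℂ)` is the subgroup fixing its complex reflex field

Shimura, *Abelian Varieties with Complex Multiplication and Modular Functions* (1998) [Shimura1998], §8.3 Prop. 28:
the reflex field `K*` of a CM type `(K, Φ)` is the subfield belonging to the subgroup `{γ | γΦ = Φ}` of the Galois group,
and `K* = ℚ(tr_Φ(x) | x ∈ K)` is generated by the type traces `tr_Φ(x) = ∑_{φ ∈ Φ} φ(x)`.  In the tree the complex
reflex field is `traceField Φ = ℚ(tr_Φ(K)) ≤ ℂ` (`ComplexReflexField.lean`).  Here, for `Aut(ℂ)` acting on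
`Hom(K, ℂ)` by composition (scoped `ringEquivCompAction`):

* `apply_cmTypeTrace` — `σ(tr_Φ(x)) = ∑_{φ ∈ Φ} (σφ)(x)`;
* `apply_cmTypeTrace_eq_of_forall_smul_mem_iff`, **`forall_apply_eq_of_forall_smul_mem_iff`** — if `σΦ = Φ` then
  `σ` fixes every type trace, hence `traceField Φ` pointwise;
* **`forall_smul_mem_iff_of_forall_apply_cmTypeTrace_eq`**, `forall_smul_mem_iff_of_forall_apply_traceField_eq` —
  conversely, if `σ` fixes every type trace (a fortiori if it fixes `traceField Φ` pointwise) then `σΦ = Φ`: the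
  difference of the indicator functions of `σΦ` and `Φ` is a vanishing linear combination of the complex embeddings,
  so it is zero by DEDEKIND's independence of characters (Mathlib `linearIndependent_monoidHom`);
* **`forall_smul_mem_iff_iff_forall_apply_traceField_eq`** — `σΦ = Φ ⟺ σ|_{K*} = id`: the stabiliser of `Φ` in
  `Aut(ℂ)` is `Aut(ℂ/K*)`.

This is the `Aut(ℂ)`-form of Prop. 28 used by the criterion «the reflex fields of two CM types meet in a real field»
(`Summits/HodgeConjecture/CorCM/ReflexFieldsMeetRealCMHodge`).  Theorems only; no definition, no `sorry`.

## References

* [Shimura1998] G. Shimura, *Abelian Varieties with Complex Multiplication and Modular Functions*, §8.3 Prop. 28.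
* [Lang2002] S. Lang, *Algebra*, 3rd ed., VI §4 Thm. 4.1 (Artin/Dedekind: independence of characters).
-/

noncomputable section

namespace Literature.NumberTheory.ComplexMultiplication

open Literature.AlgebraicGeometry.Motives (CMType)
open NumberField

variable {K : Type} [Field K] [NumberField K]

/-- `σ(tr_Φ(x)) = ∑_{φ ∈ Φ} (σ ∘ φ)(x)`. [cite: Shimura1998, §8.3 Prop. 28] -/
theorem apply_cmTypeTrace (σ : ℂ ≃+* ℂ) (Φ : CMType K) (x : K) :
    σ (cmTypeTrace Φ x) = ∑ φ ∈ (Set.toFinite Φ.1).toFinset, (σ • φ) x := by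
  rw [cmTypeTrace_apply, map_sum]
  rfl

/-- The finset of members of a type is carried by `σ` onto the finset of members of `σΦ`; so if `σΦ = Φ` the sum
`∑_{φ ∈ Φ} (σφ)(x)` is `tr_Φ(x)` again. [cite: Shimura1998, §8.3 Prop. 28] -/
theorem apply_cmTypeTrace_eq_of_forall_smul_mem_iff (σ : ℂ ≃+* ℂ) (Φ : CMType K)
    (h : ∀ χ : K →+* ℂ, σ • χ ∈ Φ.1 ↔ χ ∈ Φ.1) (x : K) : σ (cmTypeTrace Φ x) = cmTypeTrace Φ x := by
  classical
  rw [apply_cmTypeTrace, cmTypeTrace_apply]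
  -- reindex the sum along the bijection `φ ↦ σ • φ` of the finset of members
  refine Finset.sum_nbij (fun φ => σ • φ) (fun φ hφ => ?_) (fun φ _ ψ _ hφψ => smul_left_cancel σ hφψ)
    (fun ψ hψ => ?_) (fun φ _ => rfl)
  · rw [Set.Finite.mem_toFinset] at hφ ⊢
    exact (h φ).2 hφ
  · rw [Finset.mem_coe, Set.Finite.mem_toFinset] at hψ
    refine ⟨σ⁻¹ • ψ, ?_, smul_inv_smul σ ψ⟩
    rw [Finset.mem_coe, Set.Finite.mem_toFinset, ← h, smul_inv_smul]
    exact hψ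

/-- **`σΦ = Φ ⟹ σ` fixes the reflex field `traceField Φ = ℚ(tr_Φ(K))` pointwise.** [cite: Shimura1998, §8.3 Prop. 28] -/
theorem forall_apply_eq_of_forall_smul_mem_iff (σ : ℂ ≃+* ℂ) (Φ : CMType K)
    (h : ∀ χ : K →+* ℂ, σ • χ ∈ Φ.1 ↔ χ ∈ Φ.1) : ∀ z : ℂ, z ∈ traceField Φ → σ z = z := by
  -- the subfield of `ℂ` fixed by `σ` contains the generators `tr_Φ(x)`
  have hq : ∀ q : ℚ, σ (algebraMap ℚ ℂ q) = algebraMap ℚ ℂ q := fun q => by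
    rw [eq_ratCast]; exact map_ratCast σ q
  let φ : ℂ →ₐ[ℚ] ℂ := (AlgEquiv.ofRingEquiv (f := σ) hq).toAlgHom
  let D : IntermediateField ℚ ℂ :=
    ⟨AlgHom.equalizer φ (AlgHom.id ℚ ℂ), fun y (hy : σ y = y) => show σ y⁻¹ = y⁻¹ by rw [map_inv₀, hy]⟩
  have hle : traceField Φ ≤ D := by
    rw [traceField, IntermediateField.adjoin_le_iff]
    rintro _ ⟨x, rfl⟩
    exact apply_cmTypeTrace_eq_of_forall_smul_mem_iff σ Φ h x
  exact fun z hz => hle hz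

/-- **Dedekind: `σ` fixes every type trace ⟹ `σΦ = Φ`.**  If `σ(tr_Φ(x)) = tr_Φ(x)` for all `x ∈ K` then
`∑_{ψ ∈ σΦ} ψ = ∑_{φ ∈ Φ} φ` as functions `K → ℂ`, and the complex embeddings of `K` are linearly independent over `ℂ`
(independence of characters), so `σΦ = Φ`. [cite: Shimura1998, §8.3 Prop. 28] [cite: Lang2002, VI §4 Thm. 4.1] -/
theorem forall_smul_mem_iff_of_forall_apply_cmTypeTrace_eq (σ : ℂ ≃+* ℂ) (Φ : CMType K)
    (h : ∀ x : K, σ (cmTypeTrace Φ x) = cmTypeTrace Φ x) (χ : K →+* ℂ) : σ • χ ∈ Φ.1 ↔ χ ∈ Φ.1 := by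
  classical
  -- Dedekind's independence of the characters `Hom(K, ℂ) ⊂ (K →* ℂ)`
  have hli : LinearIndependent ℂ (fun χ : K →+* ℂ => (χ : K → ℂ)) :=
    (linearIndependent_monoidHom K ℂ).comp (fun χ : K →+* ℂ => χ.toMonoidHom)
      (fun a b hab => RingHom.ext fun x => DFunLike.congr_fun hab x)
  -- the coefficient vector: indicator of `σΦ` minus indicator of `Φ`
  let g : (K →+* ℂ) → ℂ := fun χ => (if σ⁻¹ • χ ∈ Φ.1 then 1 else 0) - (if χ ∈ Φ.1 then 1 else 0)
  have hsum : ∑ χ, g χ • (χ : K → ℂ) = 0 := by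
    funext x
    rw [Finset.sum_apply, Pi.zero_apply]
    simp only [Pi.smul_apply, smul_eq_mul, g, sub_mul, Finset.sum_sub_distrib, ite_mul, one_mul, zero_mul,
      ← Finset.sum_filter]
    -- `∑_{χ : σ⁻¹χ ∈ Φ} χ x = σ (tr_Φ x)` and `∑_{χ ∈ Φ} χ x = tr_Φ x`
    have h1 : ∑ χ ∈ Finset.univ.filter (fun χ : K →+* ℂ => σ⁻¹ • χ ∈ Φ.1), χ x = σ (cmTypeTrace Φ x) := by
      rw [apply_cmTypeTrace]
      refine Finset.sum_nbij (fun χ => σ⁻¹ • χ) (fun χ hχ => ?_) (fun χ _ ψ _ hχψ => smul_left_cancel σ⁻¹ hχψ)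
        (fun φ hφ => ?_) (fun χ _ => by rw [smul_inv_smul])
      · rw [Finset.mem_filter] at hχ
        rw [Set.Finite.mem_toFinset]
        exact hχ.2
      · rw [Finset.mem_coe, Set.Finite.mem_toFinset] at hφ
        refine ⟨σ • φ, ?_, inv_smul_smul σ φ⟩
        rw [Finset.mem_coe, Finset.mem_filter, inv_smul_smul]
        exact ⟨Finset.mem_univ _, hφ⟩
    have h2 : ∑ χ ∈ Finset.univ.filter (fun χ : K →+* ℂ => χ ∈ Φ.1), χ x = cmTypeTrace Φ x := by
      rw [cmTypeTrace_apply]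
      refine Finset.sum_congr (Finset.ext fun χ => ?_) fun _ _ => rfl
      rw [Finset.mem_filter, Set.Finite.mem_toFinset]
      exact ⟨fun h => h.2, fun h => ⟨Finset.mem_univ _, h⟩⟩
    rw [h1, h2, h x, sub_self]
  have hg := Fintype.linearIndependent_iff.1 hli g hsum
  -- read off the coefficient at `σ • χ`
  have hχ := hg (σ • χ)
  simp only [g, inv_smul_smul, sub_eq_zero] at hχ
  by_cases h₁ : χ ∈ Φ.1 <;> by_cases h₂ : σ • χ ∈ Φ.1 <;> simp [h₁, h₂] at hχ ⊢

/-- **`σ` fixes the reflex field pointwise ⟹ `σΦ = Φ`** (`Aut(ℂ/K*) ⊆ Stab Φ`). [cite: Shimura1998, §8.3 Prop. 28] -/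
theorem forall_smul_mem_iff_of_forall_apply_traceField_eq (σ : ℂ ≃+* ℂ) (Φ : CMType K)
    (h : ∀ z : ℂ, z ∈ traceField Φ → σ z = z) (χ : K →+* ℂ) : σ • χ ∈ Φ.1 ↔ χ ∈ Φ.1 :=
  forall_smul_mem_iff_of_forall_apply_cmTypeTrace_eq σ Φ (fun x => h _ (cmTypeTrace_mem_traceField Φ x)) χ

/-- **Shimura's Prop. 28 for `Aut(ℂ)`: the stabiliser of `Φ` is the subgroup fixing the reflex field `K* ⊂ ℂ`**:
`σΦ = Φ ⟺ σ` fixes `traceField Φ` pointwise. [cite: Shimura1998, §8.3 Prop. 28] -/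
theorem forall_smul_mem_iff_iff_forall_apply_traceField_eq (σ : ℂ ≃+* ℂ) (Φ : CMType K) :
    (∀ χ : K →+* ℂ, σ • χ ∈ Φ.1 ↔ χ ∈ Φ.1) ↔ ∀ z : ℂ, z ∈ traceField Φ → σ z = z :=
  ⟨forall_apply_eq_of_forall_smul_mem_iff σ Φ, forall_smul_mem_iff_of_forall_apply_traceField_eq σ Φ⟩

end Literature.NumberTheory.ComplexMultiplication

end
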